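import Literature.MathematicalPhysics.QuantumLattice.PairStructureFactorFejerBox
import Literature.MathematicalPhysics.QuantumLattice.HubbardNNNHoppingPairCorrelatorCertificate
import Literature.MathematicalPhysics.QuantumLattice.TorusGroundEnergyDensityLimit
import Literature.MathematicalPhysics.QuantumLattice.TorusLimitSectorGroundStatesSymmetric
import Literature.MathematicalPhysics.QuantumLattice.ApproximateEigenvectorLemmas
import HarnessLib

/-!
# Window tightness: along a torus limit the box pair long-range order of the limit state is below the
# liminf of the torus diagonals up to the small-momentum window tail ("BN7 = window tightness")

Topic `Literature/MathematicalPhysics/QuantumLattice`; namespace = path. Continuation of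
`PairStructureFactorFejerBox.lean` ((F1) Fejér identity `b_{L,n}(ψ) = L⁻² Σ_m F_n(m) S_ψ(m)`, (F2)
`s_L(ψ) ≤ b_{L,n}(ψ)`, (F3) `s_L(ψ) ≥ b_{L,n}(ψ) − T_ε(ψ)/L² − (2π²/(nε)²)·(Σ_m S_ψ(m))/L²`) to TORUS LIMITS
(`InfVolFermionState.IsTorusLimitOf`: convergence of the translation-AVERAGED expectations of local observables).

* `siteAvgPairCorr_eq_re_torusAvgExpectAt` — the translation-averaged pair correlation `C̄_L(r̄)` of a torus vector IS
  the translation-averaged expectation of the window observable `P_0† P_r` (`windowPairCorrObs`), so along a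
  torus limit `ψ_{L_j} → ω`: `C̄_{L_j}(r̄) → Re ω(P_0† P_r)` (`IsTorusLimitOf.tendsto_siteAvgPairCorr`) and
  `b_{L_j,n}(ψ_{L_j}) → B_n(ω) := n⁻⁴ Re Σ_{x,y ∈ [0,n)²} ω(P_x† P_y)` (`IsTorusLimitOf.tendsto_boxAvgPairCorr`; torus
  limits are translation invariant);
* `sum_pairStructureFactor_div_sq_le` — the local pair density `(Σ_m S_ψ(m))/L² ≤ K_g²`,
  `K_g = pairNormConst g = 2 Σ_e |g(e)|/√2`, for every unit vector;
* **`IsTorusLimitOf.re_boxAverage_le_liminf_torusDiagonal_add`** — for every `n ≥ 1` and `ε > 0`: if eventually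
  `T_ε(ψ_{L_j})/L_j² ≤ τ`, then `B_n(ω) ≤ liminf_j s_{L_j}(ψ_{L_j}) + τ + 2π²K_g²/(nε)²`;
* **`IsTorusLimitOf.le_liminf_torusDiagonal_of_forall_le_re_boxAverage`** (WINDOW TIGHTNESS ⇒ BN7): if
  `c ≤ B_n(ω)` for EVERY `n ≥ 1` and the window tails are tight (`∀ ε > 0`, eventually `T_ε/L² ≤ τ(ε)`,
  `τ(ε) → 0` as `ε ↓ 0`), then `c ≤ liminf_j s_{L_j}`;
* `sq_dWaveOrderParameterTT'_le_liminf_torusDiagonal_of_unique_symmetric` and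
  `exists_sq_dWaveOrderParameter_le_liminf_torusDiagonal_of_sectorGroundStates` — composition with the tree's
  `[U]`-conditional infinite-volume Koma–Tasaki converse
  (`IsTorusLimitOf.dWaveOrderParameterTT'_sq_le_re_boxAverage_of_unique_symmetric`,
  `…_of_sectorGroundStates_pure_of_unique_symmetric`, which floor `B_n(ω)` by `(m⋆)²` for EVERY `n`): uniqueness of
  the gauge-symmetric translation-invariant ground state AND window tightness of the torus ground-state sequence give
  `(m⋆)² ≤ liminf_j s_{L_j}` — the torus half of the Koma–Tasaki converse is EXACTLY small-momentum tightness.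

HONEST SCOPE (correcting the cell sketch `TransplantSketch5` (F4)): the inequality `B_n(ω) ≤ liminf_j s_{L_j}` does
NOT hold for a fixed `n` without the leakage term (at `n = 1`, `B_1(ω)` is the local pair density while `s_L → 0`
for every clustering tight sequence); what tightness gives is the `n → ∞` statement, which is all the
`[U]`-conditional corollaries need. No number; nothing is claimed about any Hamiltonian beyond the two conditional
corollaries, whose open inputs (`[U]`, tightness, a floor on `m⋆`) are hypotheses.

## References
* T. Koma, H. Tasaki, J. Stat. Phys. 76 (1994) 745, §1 (long-range order in symmetric finite-volume ground states
  vs. explicit symmetry breaking). [cite: KomaTasaki1994, §1]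
* T. Kennedy, E. H. Lieb, B. S. Shastry, Phys. Rev. Lett. 61 (1988) 2582–2583 (structure factor, zero mode,
  infrared control of the small momenta). [cite: KLS1988PRL, p. 2583]
* O. Bratteli, D. W. Robinson, *OAQSM 1* (1987), §4.3.1 (invariant states as averages; weak-⋆ limits).
  [cite: BratteliRobinsonI1987, §4.3.1]
-/

noncomputable section

namespace Literature.MathematicalPhysics.QuantumLattice

open Matrix Finset _root_.Filter Literature.Probability.LatticeModels HubbardWave0
open scoped _root_.Topology ComplexOrder ComplexConjugate Matrix.Norms.L2Operator

/-! ### §1. The site-averaged pair correlation is a translation-averaged expectation -/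

section Torus

variable (g : Site 2 → ℝ) (L : ℕ) [NeZero L]

/-- `Σ_v T_v (P_0† P_r̄) T_v⁻¹ = Σ_x P_x† P_{x+r̄}` (`T_v P_z T_v⁻¹ = P_{z+v}`, `relabel_translate_localPair`).
[cite: Scalapino1995, §2 eq. (2.3)] -/
theorem sum_relabel_translate_localPair_corr (r : TorusSite 2 L) :
    ∑ v : TorusSite 2 L, relabel (Orb.translate v) ((localPair g L 0)ᴴ * localPair g L r) =
      ∑ x : TorusSite 2 L, (localPair g L x)ᴴ * localPair g L (x + r) := by
  refine Finset.sum_congr rfl fun v _ => ?_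
  rw [relabel_mul, relabel_conjTranspose, relabel_translate_localPair, relabel_translate_localPair, zero_add,
    add_comm]

/-- **`C̄_L(r̄)` is the translation-averaged expectation of the window observable `P_0† P_r`**: for a window
`Λ' ⊇ pairRegion 0 ∪ pairRegion r` fitting into the torus,
`siteAvgPairCorr g L ψ (r mod L) = Re (torusAvgExpectAt L Λ' (P_0† P_r) ψ)`. [cite: Scalapino1995, §2 eq. (2.4)] -/
theorem siteAvgPairCorr_eq_re_torusAvgExpectAt {Λ' : Finset (Site 2)} (r : Site 2)
    (h0 : pairRegion (insert 0 unitSteps) 0 ⊆ Λ') (hr : pairRegion (insert 0 unitSteps) r ⊆ Λ')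
    (hInj : Set.InjOn (Torus.proj (d := 2) L) ↑Λ') (ψ : Fock (Orb (FermionTorus 2 L))) :
    siteAvgPairCorr g L ψ (Torus.proj L r) =
      (torusAvgExpectAt L Λ' (windowPairCorrObs (insert 0 unitSteps) g r h0 hr) ψ).re := by
  have hH := sum_relabel_translate_localPair_corr g L (Torus.proj L r)
  rw [← fermionEmbed_toTorusEmb_windowPairCorrObs_localPair L g r h0 hr hInj] at hH
  rw [torusAvgExpectAt_eq_expect_div_of_sum_relabel _ L hInj hH ψ, siteAvgPairCorr,
    show ((L : ℂ) ^ 2) = (((L : ℝ) ^ 2 : ℝ) : ℂ) by push_cast; rfl, Complex.div_ofReal_re]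
  congr 1
  rw [expect, Matrix.sum_mulVec, dotProduct_sum, Complex.re_sum, Complex.re_sum]
  refine Finset.sum_congr rfl fun x _ => ?_
  rw [star_mulVec_dotProduct_mulVec]

end Torus

/-! ### §2. The infinite-volume side: `ω(P_0† P_r)` and the box averages -/

namespace InfVolFermionState

variable (g : Site 2 → ℝ)

/-- `ω(P_0⋆ P_r)` is the expectation of the window observable `P_0† P_r` on `pairRegion 0 ∪ pairRegion r`.
[cite: Scalapino1995, §2 eq. (2.4)] -/
theorem pairCorr_zero_eq_expect_windowPairCorrObs (ω : InfVolFermionState 2) (r : Site 2) :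
    ω.pairCorr (insert 0 unitSteps) g 0 r =
      ω.expect (pairRegion (insert 0 unitSteps) 0 ∪ pairRegion (insert 0 unitSteps) r)
        (windowPairCorrObs (insert 0 unitSteps) g r Finset.subset_union_left Finset.subset_union_right) := by
  rw [InfVolFermionState.pairCorr, InfVolFermionState.corr_eq, windowPairCorrObs, fermionEmbed_conjTranspose]

variable {ψ : ∀ L, Fock (Orb (FermionTorus 2 L))} {Ls : ℕ → ℕ} {ω : InfVolFermionState 2}

/-- **Convergence of the translation-averaged pair correlation along a torus limit**:
`C̄_{L_j}(r mod L_j) → Re ω(P_0⋆ P_r)`. [cite: BratteliRobinsonI1987, §4.3.1] -/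
theorem IsTorusLimitOf.tendsto_siteAvgPairCorr [∀ j, NeZero (Ls j)] (hω : ω.IsTorusLimitOf ψ Ls)
    (hLs : Tendsto Ls atTop atTop) (r : Site 2) :
    Tendsto (fun j => siteAvgPairCorr g (Ls j) (ψ (Ls j)) (Torus.proj (Ls j) r)) atTop
      (𝓝 (ω.pairCorr (insert 0 unitSteps) g 0 r).re) := by
  set Λ' : Finset (Site 2) := pairRegion (insert 0 unitSteps) 0 ∪ pairRegion (insert 0 unitSteps) r with hΛ'
  have hconv := (Complex.continuous_re.tendsto _).comp
    (hω Λ' (windowPairCorrObs (insert 0 unitSteps) g r Finset.subset_union_left Finset.subset_union_right))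
  rw [pairCorr_zero_eq_expect_windowPairCorrObs]
  refine hconv.congr' ?_
  filter_upwards [eventually_injOn_proj_of_tendsto Λ' hLs] with j hj
  rw [Function.comp_apply, torusAvgExpect_eq,
    ← siteAvgPairCorr_eq_re_torusAvgExpectAt g (Ls j) r Finset.subset_union_left Finset.subset_union_right hj]

/-- The complex box average `n⁻⁴ Σ_{x,y ∈ [0,n)²} ω(P_x⋆ P_y)` has real part
`n⁻⁴ Σ_{x,y} Re ω(P_x⋆ P_y)`. [cite: Scalapino1995, §2 eq. (2.4)] -/
theorem re_boxAverage_pairCorr (ω : InfVolFermionState 2) (n : ℕ) :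
    (((n : ℂ) ^ 4)⁻¹ * ∑ x ∈ halfOpenBox 2 n, ∑ y ∈ halfOpenBox 2 n, ω.pairCorr (insert 0 unitSteps) g x y).re =
      (∑ x ∈ halfOpenBox 2 n, ∑ y ∈ halfOpenBox 2 n, (ω.pairCorr (insert 0 unitSteps) g x y).re) / (n : ℝ) ^ 4 := by
  rw [show ((n : ℂ) ^ 4)⁻¹ = ((((n : ℝ) ^ 4)⁻¹ : ℝ) : ℂ) by push_cast; rfl, Complex.re_ofReal_mul, Complex.re_sum,
    inv_mul_eq_div]
  simp_rw [Complex.re_sum]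

/-- **Convergence of the Fejér box averages along a torus limit**:
`b_{L_j,n}(ψ_{L_j}) → n⁻⁴ Re Σ_{x,y ∈ [0,n)²} ω(P_x⋆ P_y)` (torus limits are translation invariant, so
`ω(P_x⋆ P_y) = ω(P_0⋆ P_{y−x})`). [cite: BratteliRobinsonI1987, §4.3.1] -/
theorem IsTorusLimitOf.tendsto_boxAvgPairCorr [∀ j, NeZero (Ls j)] (hω : ω.IsTorusLimitOf ψ Ls)
    (hLs : Tendsto Ls atTop atTop) (n : ℕ) :
    Tendsto (fun j => boxAvgPairCorr g (Ls j) (ψ (Ls j)) n) atTop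
      (𝓝 (((n : ℂ) ^ 4)⁻¹ * ∑ x ∈ halfOpenBox 2 n, ∑ y ∈ halfOpenBox 2 n,
        ω.pairCorr (insert 0 unitSteps) g x y).re) := by
  have hTI := hω.isTranslationInvariant
  rw [re_boxAverage_pairCorr]
  have hxy : ∀ x y : Site 2, (ω.pairCorr (insert 0 unitSteps) g x y).re =
      (ω.pairCorr (insert 0 unitSteps) g 0 (y - x)).re := by
    intro x y
    have h := hTI.pairCorr_add (insert 0 unitSteps) g 0 (y - x) x
    rw [zero_add, sub_add_cancel] at h
    rw [h]
  rw [show (∑ x ∈ halfOpenBox 2 n, ∑ y ∈ halfOpenBox 2 n, (ω.pairCorr (insert 0 unitSteps) g x y).re) =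
      ∑ x ∈ halfOpenBox 2 n, ∑ y ∈ halfOpenBox 2 n, (ω.pairCorr (insert 0 unitSteps) g 0 (y - x)).re from
    Finset.sum_congr rfl fun x _ => Finset.sum_congr rfl fun y _ => hxy x y]
  unfold boxAvgPairCorr
  refine Tendsto.div_const (tendsto_finsetSum _ fun x _ => tendsto_finsetSum _ fun y _ => ?_) _
  have hproj : ∀ j, Torus.proj (Ls j) y - Torus.proj (Ls j) x = Torus.proj (Ls j) (y - x) := by
    intro j; funext i; simp [Torus.proj]
  simp_rw [hproj]
  exact hω.tendsto_siteAvgPairCorr g hLs (y - x)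

end InfVolFermionState

/-! ### §3. Uniform bounds: the local pair density and the torus diagonal -/

section Density

variable (g : Site 2 → ℝ) (L : ℕ) [NeZero L]

/-- **The local pair density is bounded**: `(Σ_m S_ψ(m))/L² = L⁻² Σ_x ‖P_x ψ‖² ≤ K_g²` for every unit vector,
`K_g = 2 Σ_e |g(e)/√2| ≥ ‖P_x‖` (`norm_localPair_le`). [cite: KLS1988PRL, p. 2582] -/
theorem sum_pairStructureFactor_div_sq_le {ψ : Fock (Orb (FermionTorus 2 L))} (hψ : star ψ ⬝ᵥ ψ = 1) :
    (∑ m, pairStructureFactor g L ψ m) / (L : ℝ) ^ 2 ≤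
      (2 * ∑ e ∈ insert (0 : Site 2) unitSteps, |g e / Real.sqrt 2|) ^ 2 := by
  set K : ℝ := 2 * ∑ e ∈ insert (0 : Site 2) unitSteps, |g e / Real.sqrt 2| with hK
  have hL2 : (0 : ℝ) < (L : ℝ) ^ 2 := pow_pos (Nat.cast_pos.2 (NeZero.pos L)) 2
  rw [sum_pairStructureFactor, div_le_iff₀ hL2]
  have hx : ∀ x : TorusSite 2 L, (star (localPair g L x *ᵥ ψ) ⬝ᵥ (localPair g L x *ᵥ ψ)).re ≤ K ^ 2 := by
    intro x
    rw [← eucNorm_sq]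
    have h1 : eucNorm (localPair g L x *ᵥ ψ) ≤ K := by
      refine (eucNorm_mulVec_le _ _).trans ?_
      rw [eucNorm_eq_one hψ, mul_one]
      exact norm_localPair_le g L x
    exact pow_le_pow_left₀ (eucNorm_nonneg _) h1 2
  calc ∑ x, (star (localPair g L x *ᵥ ψ) ⬝ᵥ (localPair g L x *ᵥ ψ)).re ≤ ∑ _x : TorusSite 2 L, K ^ 2 :=
        Finset.sum_le_sum fun x _ => hx x
    _ = K ^ 2 * (L : ℝ) ^ 2 := by
        rw [Finset.sum_const, Finset.card_univ, card_torusSite_two, nsmul_eq_mul]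
        push_cast
        ring

/-- `0 ≤ s_L(ψ)`. [cite: KLS1988PRL, p. 2582] -/
theorem torusDiagonal_nonneg (ψ : Fock (Orb (FermionTorus 2 L))) : 0 ≤ torusDiagonal g L ψ :=
  div_nonneg (pairStructureFactor_nonneg g L ψ 0) (sq_nonneg _)

/-- `s_L(ψ) ≤ (Σ_m S_ψ(m))/L²` (one nonnegative term of the sum). [cite: KLS1988PRL, p. 2582] -/
theorem torusDiagonal_le_sum_pairStructureFactor_div_sq (ψ : Fock (Orb (FermionTorus 2 L))) :
    torusDiagonal g L ψ ≤ (∑ m, pairStructureFactor g L ψ m) / (L : ℝ) ^ 2 :=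
  div_le_div_of_nonneg_right
    (Finset.single_le_sum (f := fun m => pairStructureFactor g L ψ m) (fun m _ => pairStructureFactor_nonneg g L ψ m)
      (Finset.mem_univ _)) (sq_nonneg _)

/-- `s_L(ψ) ≤ K_g²` for a unit vector. [cite: KLS1988PRL, p. 2582] -/
theorem torusDiagonal_le_of_unit {ψ : Fock (Orb (FermionTorus 2 L))} (hψ : star ψ ⬝ᵥ ψ = 1) :
    torusDiagonal g L ψ ≤ (2 * ∑ e ∈ insert (0 : Site 2) unitSteps, |g e / Real.sqrt 2|) ^ 2 :=
  (torusDiagonal_le_sum_pairStructureFactor_div_sq g L ψ).trans (sum_pairStructureFactor_div_sq_le g L hψ)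

end Density

/-! ### §4. Window tightness ⇒ BN7 -/

namespace InfVolFermionState

variable (g : Site 2 → ℝ) {ψ : ∀ L, Fock (Orb (FermionTorus 2 L))} {Ls : ℕ → ℕ} {ω : InfVolFermionState 2}

/-- **Box average of the limit vs liminf of the torus diagonals, with the window and leakage terms**: along a
torus-limit sequence of unit vectors, for every `n ≥ 1`, `ε > 0` and every eventual bound `T_ε(ψ_{L_j})/L_j² ≤ τ`,
`n⁻⁴ Re Σ_{x,y ∈ [0,n)²} ω(P_x⋆ P_y) ≤ liminf_j s_{L_j}(ψ_{L_j}) + τ + (2π²/(nε)²)·K_g²`.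
[cite: KLS1988PRL, p. 2583] [cite: BratteliRobinsonI1987, §4.3.1] -/
theorem IsTorusLimitOf.re_boxAverage_le_liminf_torusDiagonal_add [∀ j, NeZero (Ls j)]
    (hω : ω.IsTorusLimitOf ψ Ls) (hLs : Tendsto Ls atTop atTop) (h1 : ∀ j, star (ψ (Ls j)) ⬝ᵥ ψ (Ls j) = 1)
    {n : ℕ} (hn : n ≠ 0) {ε τ : ℝ} (hε : 0 < ε)
    (hτ : ∀ᶠ j in atTop, windowTail g (Ls j) (ψ (Ls j)) ε ≤ τ) :
    (((n : ℂ) ^ 4)⁻¹ * ∑ x ∈ halfOpenBox 2 n, ∑ y ∈ halfOpenBox 2 n,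
        ω.pairCorr (insert 0 unitSteps) g x y).re ≤
      liminf (fun j => torusDiagonal g (Ls j) (ψ (Ls j))) atTop + τ +
        2 * Real.pi ^ 2 / ((n : ℝ) * ε) ^ 2 * (2 * ∑ e ∈ insert (0 : Site 2) unitSteps, |g e / Real.sqrt 2|) ^ 2 := by
  set K : ℝ := 2 * ∑ e ∈ insert (0 : Site 2) unitSteps, |g e / Real.sqrt 2| with hK
  set B : ℝ := (((n : ℂ) ^ 4)⁻¹ * ∑ x ∈ halfOpenBox 2 n, ∑ y ∈ halfOpenBox 2 n,
    ω.pairCorr (insert 0 unitSteps) g x y).re with hB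
  set leak : ℝ := 2 * Real.pi ^ 2 / ((n : ℝ) * ε) ^ 2 with hleak
  have hleak0 : 0 ≤ leak := by positivity
  have hb : Tendsto (fun j => boxAvgPairCorr g (Ls j) (ψ (Ls j)) n) atTop (𝓝 B) :=
    hω.tendsto_boxAvgPairCorr g hLs n
  have hbdd : IsBoundedUnder (· ≤ ·) atTop (fun j => torusDiagonal g (Ls j) (ψ (Ls j))) :=
    isBoundedUnder_of ⟨K ^ 2, fun j => torusDiagonal_le_of_unit g (Ls j) (h1 j)⟩
  refine le_of_forall_pos_le_add fun δ hδ => ?_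
  have hev : ∀ᶠ j in atTop, B - δ - τ - leak * K ^ 2 ≤ torusDiagonal g (Ls j) (ψ (Ls j)) := by
    filter_upwards [hτ, hb.eventually (lt_mem_nhds (show B - δ < B by linarith))] with j hτj hbj
    have hF3 := boxAvgPairCorr_sub_windowTail_sub_le_torusDiagonal g (Ls j) (ψ (Ls j)) hn hε
    have hploc := mul_le_mul_of_nonneg_left (sum_pairStructureFactor_div_sq_le g (Ls j) (h1 j)) hleak0
    linarith
  have hlim := le_liminf_of_le hbdd.isCoboundedUnder_ge hev
  linarith

/-- **WINDOW TIGHTNESS ⇒ BN7.** Along a torus-limit sequence of unit vectors whose small-momentum window tails are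
tight (`∀ ε > 0`, eventually `T_ε(ψ_{L_j})/L_j² ≤ τ(ε)`, with `τ(ε) → 0` as `ε ↓ 0`), any common floor `c` on the box
averages `n⁻⁴ Re Σ_{x,y ∈ [0,n)²} ω(P_x⋆ P_y)` of the limit state (`n ≥ 1`) is a floor on `liminf_j s_{L_j}` — the
torus diagonals of the sequence. [cite: KomaTasaki1994, §1] [cite: KLS1988PRL, p. 2583] -/
theorem IsTorusLimitOf.le_liminf_torusDiagonal_of_forall_le_re_boxAverage [∀ j, NeZero (Ls j)]
    (hω : ω.IsTorusLimitOf ψ Ls) (hLs : Tendsto Ls atTop atTop) (h1 : ∀ j, star (ψ (Ls j)) ⬝ᵥ ψ (Ls j) = 1)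
    {τ : ℝ → ℝ} (hτ : ∀ ε : ℝ, 0 < ε → ∀ᶠ j in atTop, windowTail g (Ls j) (ψ (Ls j)) ε ≤ τ ε)
    (hτ0 : Tendsto τ (𝓝[>] 0) (𝓝 0)) {c : ℝ}
    (hc : ∀ n : ℕ, n ≠ 0 → c ≤ (((n : ℂ) ^ 4)⁻¹ * ∑ x ∈ halfOpenBox 2 n, ∑ y ∈ halfOpenBox 2 n,
      ω.pairCorr (insert 0 unitSteps) g x y).re) :
    c ≤ liminf (fun j => torusDiagonal g (Ls j) (ψ (Ls j))) atTop := by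
  set K : ℝ := 2 * ∑ e ∈ insert (0 : Site 2) unitSteps, |g e / Real.sqrt 2| with hK
  refine le_of_forall_pos_le_add fun δ hδ => ?_
  have hδ2 : 0 < δ / 2 := half_pos hδ
  -- a field scale with a small window tail
  obtain ⟨ε, hτε, hε⟩ := ((hτ0.eventually (gt_mem_nhds hδ2)).and self_mem_nhdsWithin).exists
  -- a box size with a small leakage
  set C : ℝ := 2 * Real.pi ^ 2 / ε ^ 2 * K ^ 2 with hC
  have hC0 : 0 ≤ C := by positivity
  obtain ⟨n, hCn, hn⟩ := (((tendsto_const_div_atTop_nhds_zero_nat C).eventually (gt_mem_nhds hδ2)).and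
    (eventually_ne_atTop 0)).exists
  have hn1 : (1 : ℝ) ≤ n := by exact_mod_cast Nat.one_le_iff_ne_zero.2 hn
  have hleak : 2 * Real.pi ^ 2 / ((n : ℝ) * ε) ^ 2 * K ^ 2 ≤ C / n := by
    rw [hC, mul_pow, show 2 * Real.pi ^ 2 / ((n : ℝ) ^ 2 * ε ^ 2) * K ^ 2 = (2 * Real.pi ^ 2 / ε ^ 2 * K ^ 2) / (n : ℝ) ^ 2
      by field_simp]
    exact div_le_div_of_nonneg_left hC0 (by positivity) (by nlinarith)
  have main := hω.re_boxAverage_le_liminf_torusDiagonal_add g hLs h1 hn hε (hτ ε hε)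
  have hcn := hc n hn
  linarith

/-! ### §5. The torus half of the Koma–Tasaki converse, modulo `[U]` and window tightness -/

/-- **(F5) `[U]` ∧ window tightness ⇒ `(m⋆)² ≤ liminf_j s_{L_j}`** for torus-limit ground-state sequences of the
grand-canonical `t–t'` Hubbard tori (`dWaveSourceTorusTT' L t' U μ 0`): composition of
`le_liminf_torusDiagonal_of_forall_le_re_boxAverage` with the tree's `[U]`-conditional infinite-volume converse
`IsTorusLimitOf.dWaveOrderParameterTT'_sq_le_re_boxAverage_of_unique_symmetric` (which floors EVERY box average by
`(m⋆)²`). [cite: KomaTasaki1994, §1] -/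
theorem IsTorusLimitOf.sq_dWaveOrderParameterTT'_le_liminf_torusDiagonal_of_unique_symmetric
    [∀ j, NeZero (Ls j)] (t' U μ : ℝ)
    (hU : ∀ ω₁ ω₂ : InfVolFermionState 2,
      ω₁.IsMeanEnergyMinimiser (hubbardTTPrimeMuInteraction 1 t' U μ) 1 → ω₁.IsGaugeInvariant →
      ω₂.IsMeanEnergyMinimiser (hubbardTTPrimeMuInteraction 1 t' U μ) 1 → ω₂.IsGaugeInvariant → ω₁ = ω₂)
    (hω : ω.IsTorusLimitOf ψ Ls) (hLs : Tendsto Ls atTop atTop)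
    (hunit : ∀ j, star (ψ (Ls j)) ⬝ᵥ ψ (Ls j) = 1) {N : ℕ → ℕ} (hN : ∀ j, IsNParticle (N j) (ψ (Ls j)))
    (hgs : ∀ j, dWaveSourceTorusTT' (Ls j) t' U μ 0 *ᵥ ψ (Ls j) =
      (((dWaveSourceTorusTT' (Ls j) t' U μ 0).groundEnergy : ℝ) : ℂ) • ψ (Ls j))
    {τ : ℝ → ℝ} (hτ : ∀ ε : ℝ, 0 < ε → ∀ᶠ j in atTop, windowTail dWaveFormFactor (Ls j) (ψ (Ls j)) ε ≤ τ ε)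
    (hτ0 : Tendsto τ (𝓝[>] 0) (𝓝 0)) :
    dWaveOrderParameterTT' t' U μ ^ 2 ≤ liminf (fun j => torusDiagonal dWaveFormFactor (Ls j) (ψ (Ls j))) atTop :=
  hω.le_liminf_torusDiagonal_of_forall_le_re_boxAverage dWaveFormFactor hLs hunit hτ hτ0 fun _ hn =>
    hω.dWaveOrderParameterTT'_sq_le_re_boxAverage_of_unique_symmetric t' U μ hU hLs hunit hN hgs hn

/-- **(F6) SUMMIT-SIDE form**: for an admissible sequence of sector ground states of the pure Hubbard tori
`hubbardTorus 2 L 1 U` (sectors `(rectN n L, S^z = 0)`, `U ≥ 0`, `0 < n < 2`) with torus limit `ω`: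
`[U at every μ]` ∧ window tightness ⇒ for the supporting chemical potential `μ` of `ω`,
`ω` is a mean-energy minimiser of `hubbardTTPrimeMuInteraction 1 0 U μ` and `m⋆(U,μ)² ≤ liminf_j s_{L_j}` — composition
with `IsTorusLimitOf.dWaveOrderParameter_sq_le_re_boxAverage_of_sectorGroundStates_pure_of_unique_symmetric`.
The open inputs (`[U]`, tightness, a floor on `m⋆`) remain hypotheses. [cite: KomaTasaki1994, §1] -/
theorem IsTorusLimitOf.exists_sq_dWaveOrderParameter_le_liminf_torusDiagonal_of_sectorGroundStates
    [∀ j, NeZero (Ls j)] {U n : ℝ} (hU : 0 ≤ U) (hn0 : 0 < n) (hn2 : n < 2)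
    (hU1 : ∀ (μ : ℝ) (ω₁ ω₂ : InfVolFermionState 2),
      ω₁.IsMeanEnergyMinimiser (hubbardTTPrimeMuInteraction 1 0 U μ) 1 → ω₁.IsGaugeInvariant →
      ω₂.IsMeanEnergyMinimiser (hubbardTTPrimeMuInteraction 1 0 U μ) 1 → ω₂.IsGaugeInvariant → ω₁ = ω₂)
    (hω : ω.IsTorusLimitOf ψ Ls) (hLs : Tendsto Ls atTop atTop)
    (hψ : ∀ j, IsGroundStateInSector (hubbardTorus 2 (Ls j) 1 U) (ThermodynamicLimit.rectN n (Ls j)) 0 (ψ (Ls j)))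
    (h1 : ∀ j, star (ψ (Ls j)) ⬝ᵥ ψ (Ls j) = 1) {τ : ℝ → ℝ}
    (hτ : ∀ ε : ℝ, 0 < ε → ∀ᶠ j in atTop, windowTail dWaveFormFactor (Ls j) (ψ (Ls j)) ε ≤ τ ε)
    (hτ0 : Tendsto τ (𝓝[>] 0) (𝓝 0)) :
    ∃ μ : ℝ, ω.IsMeanEnergyMinimiser (hubbardTTPrimeMuInteraction 1 0 U μ) 1 ∧
      dWaveOrderParameter U μ ^ 2 ≤ liminf (fun j => torusDiagonal dWaveFormFactor (Ls j) (ψ (Ls j))) atTop := by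
  obtain ⟨μ, hμ, hbox⟩ :=
    hω.dWaveOrderParameter_sq_le_re_boxAverage_of_sectorGroundStates_pure_of_unique_symmetric hU hn0 hn2 hU1 hLs hψ h1
  exact ⟨μ, hμ, hω.le_liminf_torusDiagonal_of_forall_le_re_boxAverage dWaveFormFactor hLs h1 hτ hτ0 hbox⟩

end InfVolFermionState

end Literature.MathematicalPhysics.QuantumLattice
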